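import Literature.AlgebraicGeometry.RealAlgebraic.ComplexOrientationFormulaFibreSum
import Literature.Analysis.Complex.UpperHalfPlanePuiseuxContour
import Literature.FieldTheory.AlgClosed.PuiseuxAtInfinityAlgebraic
import HarnessLib

/-!
# The signed fibre sum: boundary values on the real axis and the expansion at infinity

Sibling proof file of `ComplexOrientationFormula.lean` (topic
`Literature/AlgebraicGeometry/RealAlgebraic`), sequel to `ComplexOrientationFormulaFibreSum.lean`
(same setting and hypotheses: `p`, direction `c`, monic `Q` irreducible over `ℂ` with fibre roots
the points of the curve on the sheared lines, a half `H` with the non-real locus `H ⊔ conj H`, and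
the signed fibre sum `F`). Everything here is PROVED; no definition and no named fact is
introduced.

* `exists_sheets_tendsto_fibreSum_real` — at a real `ξ₀ = x` with simple fibre: local sheets
  `yⱼ` on a disc around `x`, constant signs `ηⱼ = ±1` of the upper half-sheets, and the boundary
  value `F(ξ) → Σⱼ ηⱼ yⱼ(x)` as `ξ → x` inside the upper half-plane; a non-real root `yⱼ(x)`
  already carries the sign `ηⱼ` (`conj`-symmetry then kills the non-real roots in the real
  part: `re_sum_sheets_eq`, the boundary function `J(x) = Σ_{yⱼ(x) real} ηⱼ yⱼ(x)`).
* `exists_fibreSum_eq_puiseuxSum` — for `Im u > 0`, `|u| ≥ R₀`: `F(u) = Σ_v η_v ỹ_v(u)` with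
  `η_v = ±1` and `ỹ_v` the convergent Puiseux branches at infinity with ALGEBRAIC coefficients
  (`PuiseuxInfinityAlgebraic.exists_algebraicBranches_atInfinity`), in the shape consumed by
  `BoundaryContour.tendsto_re_threeSides_puiseuxSum`.

[folklore]

## References

* V. A. Rokhlin, Complex orientations of real algebraic curves, Funct. Anal. Appl. 8 (1974)
  331–334, §§2–3. [Rokhlin1974]
* E. Brieskorn, H. Knörrer, *Plane Algebraic Curves* (1986), §8.3. [folklore]
-/

noncomputable section

open Polynomial Set Filter Metric MvPolynomial Complex
open scoped _root_.Topology _root_.ComplexConjugate Classical Real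

namespace Literature.AlgebraicGeometry.RealAlgebraic

namespace Sheets

variable {p : MvPolynomial (Fin 2) ℚ} {c : ℚ} {Q : ℚ[X][X]} {H : Set (Fin 2 → ℂ)} {F : ℂ → ℂ}

/-! ### Conjugation symmetry of the fibres over real points -/

/-- Over a real `x` the fibre polynomial has real coefficients: `conj` permutes its roots.
[folklore] -/
theorem eval_conj_fibre_real (Q : ℚ[X][X]) (x : ℝ) (y : ℂ) :
    (Q.map (eval₂RingHom (algebraMap ℚ ℂ) ↑x)).eval (conj y) = conj ((Q.map (eval₂RingHom (algebraMap ℚ ℂ) ↑x)).eval y) := by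
  rw [Polynomial.eval_map, Polynomial.eval_map, Polynomial.hom_eval₂]
  congr 1
  refine Polynomial.ringHom_ext (fun q => ?_) ?_
  · simp
  · simp [Complex.conj_ofReal]

/-- The point over a real `x` attached to `conj y` is the conjugate point. [folklore] -/
theorem star_pt_real (c : ℚ) (x : ℝ) (y : ℂ) :
    star (![↑x + (c : ℂ) * y, y] : Fin 2 → ℂ) = (![↑x + (c : ℂ) * (conj y), (conj y)] : Fin 2 → ℂ) := by
  funext i
  fin_cases i
  · simp [Complex.conj_ofReal]
  · simp

/-- The sign of the conjugate of a non-real point is the opposite sign (the two halves are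
interchanged by `conj`). [cite: Rokhlin1974, §2] -/
theorem sign_star (hN : nonRealLocus p = H ∪ star '' H) (hdisj : Disjoint H (star '' H))
    {w : Fin 2 → ℂ} (hw : w ∈ nonRealLocus p) :
    (if star w ∈ H then (1 : ℂ) else -1) = -(if w ∈ H then (1 : ℂ) else -1) := by
  by_cases h : w ∈ H
  · have h' : star w ∉ H := fun h' =>
      Set.disjoint_left.1 hdisj h' ⟨w, h, rfl⟩
    rw [if_pos h, if_neg h']
  · have hw' : w ∈ star '' H := by
      rw [hN] at hw
      exact hw.resolve_left h
    obtain ⟨w', hw'H, rfl⟩ := hw'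
    have : star (star w') = w' := star_star w'
    rw [this, if_pos hw'H, if_neg h, neg_neg]

/-! ### Signs along sheets: the general (non-real) version -/

/-- Along a preconnected family of fibre roots whose points are non-real, the sign is constant.
[folklore] -/
theorem sign_sheet_eq_of_mem (hH : IsHalf p H) (hN : nonRealLocus p = H ∪ star '' H)
    (hdisj : Disjoint H (star '' H)) {D : Set ℂ} (hD : IsPreconnected D)
    {g : ℂ → ℂ} (hg : ContinuousOn g D)
    (hmem : ∀ ξ ∈ D, (![ξ + (c : ℂ) * (g ξ), (g ξ)] : Fin 2 → ℂ) ∈ nonRealLocus p)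
    {ξ₀ : ℂ} (hξ₀ : ξ₀ ∈ D) {ξ : ℂ} (hξ : ξ ∈ D) :
    (if (![ξ + (c : ℂ) * (g ξ), (g ξ)] : Fin 2 → ℂ) ∈ H then (1 : ℂ) else -1) = (if (![ξ₀ + (c : ℂ) * (g ξ₀), (g ξ₀)] : Fin 2 → ℂ) ∈ H then (1 : ℂ) else -1) := by
  set Φ : ℂ → Fin 2 → ℂ := fun ξ => ![ξ + (c : ℂ) * g ξ, g ξ] with hΦ
  have hcont : ContinuousOn Φ D := by
    refine continuousOn_pi.2 fun i => ?_
    fin_cases i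
    · exact (continuousOn_id.add (continuousOn_const.mul hg))
    · exact hg
  have hpre : IsPreconnected (Φ '' D) := hD.image Φ hcont
  have hsub : Φ '' D ⊆ nonRealLocus p := by
    rintro _ ⟨ξ, hξ, rfl⟩
    exact hmem ξ hξ
  exact sign_eq_of_isPreconnected hH hN hdisj hpre hsub (mem_image_of_mem Φ hξ₀)
    (mem_image_of_mem Φ hξ)

/-! ### Boundary values at a real point with simple fibre -/

/-- **Sheets and boundary value at a good real point.** Let `x ∈ ℝ` with `g(x) ≠ 0` (`g` from
the Bézout identity, so the fibre over `x` is simple). Then on a disc around `x` there are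
holomorphic sheets `y₁, …, y_d` exhausting the fibres, with signs `ηⱼ = ±1` such that
`η(ξ, yⱼ(ξ)) = ηⱼ` for `Im ξ > 0` in the disc (the upper half-sheet of `yⱼ` lies in `H` iff
`ηⱼ = 1`), `η(x, yⱼ(x)) = ηⱼ` whenever `yⱼ(x)` is non-real, and `F(ξ) → Σⱼ ηⱼ yⱼ(x)` as
`ξ → x` within the upper half-plane. [folklore] -/
theorem exists_sheets_tendsto_fibreSum_real (hH : IsHalf p H)
    (hN : nonRealLocus p = H ∪ star '' H) (hdisj : Disjoint H (star '' H)) (hmonic : Q.Monic)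
    (hQp : ∀ ξ y : ℂ, (Q.map (eval₂RingHom (algebraMap ℚ ℂ) ξ)).eval y = 0 ↔
      aeval (![ξ + (c : ℂ) * y, y] : Fin 2 → ℂ) p = 0)
    (hF : ∀ ξ : ℂ, F ξ = (((Q.map (eval₂RingHom (algebraMap ℚ ℂ) ξ)).roots.map fun y =>
      (if (![ξ + (c : ℂ) * y, y] : Fin 2 → ℂ) ∈ H then (1 : ℂ) else -1) * y)).sum)
    {A B : ℚ[X][X]} {g : ℚ[X]} (hbez : A * Q + B * derivative Q = Polynomial.C g)
    {x : ℝ} (hg : Polynomial.aeval (x : ℂ) g ≠ 0) :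
    ∃ ε > 0, ∃ y : Fin Q.natDegree → ℂ → ℂ, ∃ η : Fin Q.natDegree → ℂ,
      (∀ j, ∀ ξ ∈ ball (x : ℂ) ε, AnalyticAt ℂ (y j) ξ) ∧
      (∀ ξ ∈ ball (x : ℂ) ε, Function.Injective fun j => y j ξ) ∧
      (∀ ξ ∈ ball (x : ℂ) ε, (Q.map (eval₂RingHom (algebraMap ℚ ℂ) ξ)).roots = Finset.univ.val.map fun j => y j ξ) ∧
      (∀ j, η j = 1 ∨ η j = -1) ∧
      (∀ j, ∀ ξ ∈ ball (x : ℂ) ε, 0 < ξ.im → (if (![ξ + (c : ℂ) * (y j ξ), (y j ξ)] : Fin 2 → ℂ) ∈ H then (1 : ℂ) else -1) = η j) ∧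
      (∀ j, (y j x).im ≠ 0 → (if (![↑x + (c : ℂ) * (y j x), (y j x)] : Fin 2 → ℂ) ∈ H then (1 : ℂ) else -1) = η j) ∧
      Tendsto F (𝓝[{z : ℂ | 0 < z.im}] x) (𝓝 (∑ j, η j * y j x)) := by
  have hsimple : ∀ y : ℂ, (Q.map (eval₂RingHom (algebraMap ℚ ℂ) ↑x)).IsRoot y → ¬ (derivative (Q.map (eval₂RingHom (algebraMap ℚ ℂ) ↑x))).IsRoot y :=
    fun y hy hy' => hg (aeval_eq_zero_of_isRoot_of_isRoot_derivative hbez hy hy')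
  obtain ⟨ε, hε, y, hya, hyinj, hroots⟩ := exists_localSheets hmonic hsimple
  have hyroot : ∀ j, ∀ ξ ∈ ball (x : ℂ) ε, (Q.map (eval₂RingHom (algebraMap ℚ ℂ) ξ)).eval (y j ξ) = 0 := by
    intro j ξ hξ
    have hmem : y j ξ ∈ (Q.map (eval₂RingHom (algebraMap ℚ ℂ) ξ)).roots := by
      rw [hroots ξ hξ]
      exact Multiset.mem_map.2 ⟨j, Finset.mem_univ_val j, rfl⟩
    exact ((mem_roots (hmonic.map _).ne_zero).1 hmem).eq_zero
  have hycont : ∀ j, ContinuousOn (y j) (ball (x : ℂ) ε) := fun j ξ hξ =>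
    (hya j ξ hξ).continuousAt.continuousWithinAt
  -- the upper half-disc and a base point in it
  set D : Set ℂ := ball (x : ℂ) ε ∩ {z : ℂ | 0 < z.im} with hD
  have hDpre : IsPreconnected D :=
    ((convex_ball (x : ℂ) ε).inter (convex_halfSpace_im_gt 0)).isPreconnected
  set ξ₁ : ℂ := (x : ℂ) + (ε / 2 : ℝ) * I with hξ₁
  have hξ₁ball : ξ₁ ∈ ball (x : ℂ) ε := by
    rw [mem_ball_iff_norm, hξ₁, add_sub_cancel_left, norm_mul, Complex.norm_I, mul_one,
      Complex.norm_real, Real.norm_eq_abs, abs_of_pos (by positivity)]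
    linarith
  have hξ₁im : 0 < ξ₁.im := by simp [hξ₁, hε]
  have hξ₁D : ξ₁ ∈ D := ⟨hξ₁ball, hξ₁im⟩
  set η : Fin Q.natDegree → ℂ := fun j => (if (![ξ₁ + (c : ℂ) * (y j ξ₁), (y j ξ₁)] : Fin 2 → ℂ) ∈ H then (1 : ℂ) else -1) with hη
  have hηD : ∀ j, ∀ ξ ∈ D, (if (![ξ + (c : ℂ) * (y j ξ), (y j ξ)] : Fin 2 → ℂ) ∈ H then (1 : ℂ) else -1) = η j := by
    intro j ξ hξ
    exact sign_sheet_eq hH hN hdisj hQp hDpre (fun z hz => hz.2) ((hycont j).mono inter_subset_left)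
      (fun z hz => hyroot j z hz.1) hξ₁D hξ
  refine ⟨ε, hε, y, η, hya, hyinj, hroots, fun j => ?_, fun j ξ hξ hξim => hηD j ξ ⟨hξ, hξim⟩,
    fun j hj => ?_, ?_⟩
  · simp only [hη]
    split_ifs
    · exact Or.inl rfl
    · exact Or.inr rfl
  · -- a non-real root: the whole sheet near `x` is non-real, so the sign at `x` is `η j`
    have hxball : (x : ℂ) ∈ ball (x : ℂ) ε := mem_ball_self hε
    have hcont : ContinuousAt (fun ξ => (y j ξ).im) x :=
      Complex.continuous_im.continuousAt.comp (hya j x hxball).continuousAt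
    have hev : ∀ᶠ ξ in 𝓝 (x : ℂ), (y j ξ).im ≠ 0 ∧ ξ ∈ ball (x : ℂ) ε :=
      (hcont.eventually_ne hj).and (ball_mem_nhds _ hε)
    obtain ⟨ε', hε', hball'⟩ := Metric.eventually_nhds_iff_ball.1 hev
    set ξ₂ : ℂ := (x : ℂ) + (min ε' ε / 2 : ℝ) * I with hξ₂
    have hmin : 0 < min ε' ε := lt_min hε' hε
    have hξ₂norm : ‖ξ₂ - x‖ = min ε' ε / 2 := by
      rw [hξ₂, add_sub_cancel_left, norm_mul, Complex.norm_I, mul_one, Complex.norm_real,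
        Real.norm_eq_abs, abs_of_pos (by positivity)]
    have hξ₂ball' : ξ₂ ∈ ball (x : ℂ) ε' := by
      rw [mem_ball_iff_norm, hξ₂norm]; linarith [min_le_left ε' ε]
    have hξ₂ball : ξ₂ ∈ ball (x : ℂ) ε := by
      rw [mem_ball_iff_norm, hξ₂norm]; linarith [min_le_right ε' ε]
    have hξ₂im : 0 < ξ₂.im := by simp [hξ₂, hmin]
    have h1 : (if (![↑x + (c : ℂ) * (y j x), (y j x)] : Fin 2 → ℂ) ∈ H then (1 : ℂ) else -1) = (if (![ξ₂ + (c : ℂ) * (y j ξ₂), (y j ξ₂)] : Fin 2 → ℂ) ∈ H then (1 : ℂ) else -1) := by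
      refine sign_sheet_eq_of_mem hH hN hdisj (convex_ball (x : ℂ) ε').isPreconnected
        ((hycont j).mono fun z hz => (hball' z hz).2) (fun z hz => ?_) hξ₂ball' (mem_ball_self hε')
      exact ⟨(hQp z _).1 (hyroot j z (hball' z hz).2), 1, by simpa using (hball' z hz).1⟩
    rw [h1, hηD j ξ₂ ⟨hξ₂ball, hξ₂im⟩]
  · -- the boundary value
    have hev : (fun ξ => ∑ j, η j * y j ξ) =ᶠ[𝓝[{z : ℂ | 0 < z.im}] (x : ℂ)] F := by
      have hDmem : D ∈ 𝓝[{z : ℂ | 0 < z.im}] (x : ℂ) := by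
        rw [hD, inter_comm]
        exact inter_mem_nhdsWithin _ (ball_mem_nhds _ hε)
      filter_upwards [hDmem] with ξ hξ
      rw [fibreSum_eq_sum_sheets hF (hroots ξ hξ.1)]
      exact Finset.sum_congr rfl fun j _ => by rw [hηD j ξ hξ]
    refine Tendsto.congr' hev ?_
    have hc : ContinuousAt (fun ξ => ∑ j, η j * y j ξ) x :=
      tendsto_finsetSum _ fun j _ => ((hya j x (mem_ball_self hε)).continuousAt.const_mul _)
    exact hc.tendsto.mono_left nhdsWithin_le_nhds

/-- **The real part of the boundary value**: with sheets and signs as above at a real `x`,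
`Re Σⱼ ηⱼ yⱼ(x) = Σ_{yⱼ(x) real} ηⱼ yⱼ(x)` — the non-real roots come in conjugate pairs lying in
opposite halves. [cite: Rokhlin1974, §2] -/
theorem re_sum_sheets_eq (hN : nonRealLocus p = H ∪ star '' H) (hdisj : Disjoint H (star '' H))
    (hmonic : Q.Monic)
    (hQp : ∀ ξ y : ℂ, (Q.map (eval₂RingHom (algebraMap ℚ ℂ) ξ)).eval y = 0 ↔
      aeval (![ξ + (c : ℂ) * y, y] : Fin 2 → ℂ) p = 0)
    {ι : Type*} [Fintype ι] [DecidableEq ι] {x : ℝ} {y : ι → ℂ} (hyinj : Function.Injective y)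
    (hroots : (Q.map (eval₂RingHom (algebraMap ℚ ℂ) ↑x)).roots = Finset.univ.val.map y) {η : ι → ℂ}
    (hη : ∀ j, η j = 1 ∨ η j = -1) (hηnr : ∀ j, (y j).im ≠ 0 → (if (![↑x + (c : ℂ) * (y j), (y j)] : Fin 2 → ℂ) ∈ H then (1 : ℂ) else -1) = η j) :
    (∑ j, η j * y j).re = ∑ j ∈ Finset.univ.filter (fun j => (y j).im = 0), (η j).re * (y j).re := by
  classical
  have hηim : ∀ j, (η j).im = 0 := fun j => by rcases hη j with h | h <;> simp [h]
  have hre : ∀ j, (η j * y j).re = (η j).re * (y j).re - (η j).im * (y j).im := fun j => Complex.mul_re _ _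
  rw [Complex.re_sum, ← Finset.sum_filter_add_sum_filter_not Finset.univ (fun j => (y j).im = 0)]
  have h1 : ∑ j ∈ Finset.univ.filter (fun j => (y j).im = 0), (η j * y j).re =
      ∑ j ∈ Finset.univ.filter (fun j => (y j).im = 0), (η j).re * (y j).re := by
    refine Finset.sum_congr rfl fun j hj => ?_
    rw [hre, (Finset.mem_filter.1 hj).2, mul_zero, sub_zero]
  rw [h1, add_eq_left]
  -- the non-real roots: pair `y j` with its conjugate
  have hroot_iff : ∀ z : ℂ, z ∈ (Q.map (eval₂RingHom (algebraMap ℚ ℂ) ↑x)).roots ↔ (Q.map (eval₂RingHom (algebraMap ℚ ℂ) ↑x)).eval z = 0 := fun z =>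
    mem_roots (hmonic.map _).ne_zero
  have hconj : ∀ j, ∃ k, y k = conj (y j) := by
    intro j
    have hj : (Q.map (eval₂RingHom (algebraMap ℚ ℂ) ↑x)).eval (y j) = 0 :=
      (hroot_iff _).1 (by rw [hroots]; exact Multiset.mem_map.2 ⟨j, Finset.mem_univ_val j, rfl⟩)
    have hk : conj (y j) ∈ (Q.map (eval₂RingHom (algebraMap ℚ ℂ) ↑x)).roots := by
      rw [hroot_iff, eval_conj_fibre_real, hj, map_zero]
    rw [hroots] at hk
    obtain ⟨k, -, hk⟩ := Multiset.mem_map.1 hk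
    exact ⟨k, hk⟩
  choose k hk using hconj
  have hkk : ∀ j, k (k j) = j := fun j => hyinj (by rw [hk, hk, Complex.conj_conj])
  have hηk : ∀ j, (y j).im ≠ 0 → η (k j) = -η j := by
    intro j hj
    have hkj : (y (k j)).im ≠ 0 := by rw [hk, Complex.conj_im]; exact neg_ne_zero.2 hj
    rw [← hηnr j hj, ← hηnr (k j) hkj, hk, ← star_pt_real]
    refine sign_star hN hdisj ⟨(hQp _ _).1 ?_, 1, by simpa using hj⟩
    exact (hroot_iff _).1 (by rw [hroots]; exact Multiset.mem_map.2 ⟨j, Finset.mem_univ_val j, rfl⟩)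
  refine Finset.sum_involution (fun j _ => k j) (fun j hj => ?_) (fun j hj _ => ?_)
    (fun j hj => ?_) (fun j hj => hkk j)
  · have hj' : (y j).im ≠ 0 := (Finset.mem_filter.1 hj).2
    rw [hre, hre, hηk j hj', hk, Complex.conj_re, Complex.conj_im, hηim, Complex.neg_re,
      Complex.neg_im, hηim]
    ring
  · have hj' : (y j).im ≠ 0 := (Finset.mem_filter.1 hj).2
    intro h
    apply hj'
    have := hk j
    rw [h] at this
    -- `y j = conj (y j)` forces a real value
    have him := congrArg Complex.im this
    rw [Complex.conj_im] at him
    linarith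
  · have hj' : (y j).im ≠ 0 := (Finset.mem_filter.1 hj).2
    refine Finset.mem_filter.2 ⟨Finset.mem_univ _, ?_⟩
    rw [hk, Complex.conj_im]
    exact neg_ne_zero.2 hj'


/-! ### The expansion at infinity over the upper half-plane -/

/-- The region `{Im u > 0, |u| ≥ 2R}` lies in the union of the three convex pieces
`{Re u > R, Im u > 0}`, `{Im u > R}`, `{Re u < -R, Im u > 0}` (`R ≥ 0`). [folklore] -/
theorem mem_threePieces {R : ℝ} (hR : 0 ≤ R) {u : ℂ} (hu : 0 < u.im) (hRu : 2 * R ≤ ‖u‖) :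
    u ∈ ({u : ℂ | R < u.re} ∩ {u : ℂ | 0 < u.im}) ∪ {u : ℂ | R < u.im} ∪
      ({u : ℂ | u.re < -R} ∩ {u : ℂ | 0 < u.im}) := by
  by_cases h1 : R < u.re
  · exact Or.inl (Or.inl ⟨h1, hu⟩)
  by_cases h2 : u.re < -R
  · exact Or.inr ⟨h2, hu⟩
  refine Or.inl (Or.inr ?_)
  simp only [not_lt] at h1 h2
  have hsq : ‖u‖ ^ 2 = u.re ^ 2 + u.im ^ 2 := by
    rw [Complex.sq_norm, Complex.normSq_apply]; ring
  have hre : u.re ^ 2 ≤ R ^ 2 := by nlinarith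
  have h4 : (2 * R) ^ 2 ≤ ‖u‖ ^ 2 := by gcongr
  show R < u.im
  nlinarith

/-- The union of the three pieces is preconnected. [folklore] -/
theorem isPreconnected_threePieces (R : ℝ) :
    IsPreconnected (({u : ℂ | R < u.re} ∩ {u : ℂ | 0 < u.im}) ∪ {u : ℂ | R < u.im} ∪
      ({u : ℂ | u.re < -R} ∩ {u : ℂ | 0 < u.im})) := by
  have hA : IsPreconnected ({u : ℂ | R < u.re} ∩ {u : ℂ | 0 < u.im}) :=
    ((convex_halfSpace_re_gt R).inter (convex_halfSpace_im_gt 0)).isPreconnected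
  have hB : IsPreconnected {u : ℂ | R < u.im} := (convex_halfSpace_im_gt R).isPreconnected
  have hC : IsPreconnected ({u : ℂ | u.re < -R} ∩ {u : ℂ | 0 < u.im}) :=
    ((convex_halfSpace_re_lt (-R)).inter (convex_halfSpace_im_gt 0)).isPreconnected
  set a : ℝ := |R| + 1 with ha
  have haR : R < a := by have := le_abs_self R; linarith
  have ha0 : 0 < a := by positivity
  have hAB : IsPreconnected (({u : ℂ | R < u.re} ∩ {u : ℂ | 0 < u.im}) ∪ {u : ℂ | R < u.im}) := by
    refine IsPreconnected.union ((a : ℂ) + a * I) ⟨?_, ?_⟩ ?_ hA hB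
    · show R < ((a : ℂ) + a * I).re
      simpa using haR
    · show 0 < ((a : ℂ) + a * I).im
      simpa using ha0
    · show R < ((a : ℂ) + a * I).im
      simpa using haR
  refine IsPreconnected.union (-(a : ℂ) + a * I) (Or.inr ?_) ⟨?_, ?_⟩ hAB hC
  · show R < (-(a : ℂ) + a * I).im
    simpa using haR
  · show (-(a : ℂ) + a * I).re < -R
    simpa using haR
  · show 0 < (-(a : ℂ) + a * I).im
    simpa using ha0

/-- Points of the three pieces have modulus `> R` and lie in the upper half-plane (`R ≥ 0`).
[folklore] -/
theorem lt_norm_of_mem_threePieces {R : ℝ} (hR : 0 ≤ R) {u : ℂ}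
    (hu : u ∈ ({u : ℂ | R < u.re} ∩ {u : ℂ | 0 < u.im}) ∪ {u : ℂ | R < u.im} ∪
      ({u : ℂ | u.re < -R} ∩ {u : ℂ | 0 < u.im})) : R < ‖u‖ ∧ 0 < u.im := by
  rcases hu with (⟨h1, h2⟩ | h1) | ⟨h1, h2⟩
  · exact ⟨h1.trans_le ((le_abs_self _).trans (abs_re_le_norm u)), h2⟩
  · exact ⟨h1.trans_le ((le_abs_self _).trans (abs_im_le_norm u)), hR.trans_lt h1⟩
  · refine ⟨?_, h2⟩
    have h1' : u.re < -R := h1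
    have : R < |u.re| := by rw [abs_of_neg (by linarith)]; linarith
    exact this.trans_le (abs_re_le_norm u)

/-- **The fibre sum near infinity is a signed sum of Puiseux branches with algebraic
coefficients.** For `Im u > 0` and `|u| ≥ R₀` (some `R₀`),
`F(u) = Σ_{v ∈ S} η_v · (Σ_{i<N_v} v_i s(u)ⁱ + s(u)^{N_v} ρ_v(s(u))) / s(u)^N`, `s(u) = u^{-1/n}`
the branch `exp(-logU(u)/n)`, with `η_v = ±1`, `ρ_v` analytic on `|s| < r`, `N_v ≥ N + n + 2` and
the coefficients `v_i ∈ ℚ̄`. [folklore] -/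
theorem exists_fibreSum_eq_puiseuxSum (hH : IsHalf p H) (hN : nonRealLocus p = H ∪ star '' H)
    (hdisj : Disjoint H (star '' H)) (hmonic : Q.Monic)
    (hirr : Irreducible (Q.map (mapRingHom (algebraMap ℚ ℂ)))) (hd : 0 < Q.natDegree)
    (hQp : ∀ ξ y : ℂ, (Q.map (eval₂RingHom (algebraMap ℚ ℂ) ξ)).eval y = 0 ↔
      aeval (![ξ + (c : ℂ) * y, y] : Fin 2 → ℂ) p = 0)
    (hF : ∀ ξ : ℂ, F ξ = (((Q.map (eval₂RingHom (algebraMap ℚ ℂ) ξ)).roots.map fun y =>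
      (if (![ξ + (c : ℂ) * y, y] : Fin 2 → ℂ) ∈ H then (1 : ℂ) else -1) * y)).sum) :
    ∃ (n : ℕ) (_ : 0 < n) (N : ℕ) (S : Finset (PowerSeries (algebraicClosure ℚ ℂ)))
      (Nv : PowerSeries (algebraicClosure ℚ ℂ) → ℕ) (ρ : PowerSeries (algebraicClosure ℚ ℂ) → ℂ → ℂ)
      (r : ℝ) (η : PowerSeries (algebraicClosure ℚ ℂ) → ℝ) (R₀ : ℝ),
      0 < r ∧ S.card = Q.natDegree ∧ (∀ v ∈ S, N + n + 2 ≤ Nv v) ∧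
      (∀ v ∈ S, ∀ s ∈ ball (0 : ℂ) r, AnalyticAt ℂ (ρ v) s) ∧ (∀ v ∈ S, η v = 1 ∨ η v = -1) ∧
      ∀ u : ℂ, 0 < u.im → R₀ ≤ ‖u‖ →
        F u = ∑ v ∈ S, (η v : ℂ) *
          ((∑ i ∈ Finset.range (Nv v),
              algebraMap (algebraicClosure ℚ ℂ) ℂ (PowerSeries.coeff i v) * exp (-(log (-I * u) + (π / 2 : ℝ) * I) / n) ^ i +
            exp (-(log (-I * u) + (π / 2 : ℝ) * I) / n) ^ (Nv v) * ρ v (exp (-(log (-I * u) + (π / 2 : ℝ) * I) / n))) / exp (-(log (-I * u) + (π / 2 : ℝ) * I) / n) ^ N) := by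
  classical
  obtain ⟨n, hn, N, S, Nv, ρ, r, hr, hcard, hNv, hρ, hroots, hdist⟩ :=
    Literature.FieldTheory.AlgClosed.PuiseuxInfinityAlgebraic.exists_algebraicBranches_atInfinity
      Q hmonic hirr hd
  -- the branch `s(u)` and the branches `ỹ_v(u)`
  obtain ⟨sf, hsf⟩ : ∃ sf : ℂ → ℂ, ∀ u, sf u = exp (-(log (-I * u) + (π / 2 : ℝ) * I) / n) := ⟨_, fun _ => rfl⟩
  obtain ⟨Y, hY⟩ : ∃ Y : PowerSeries (algebraicClosure ℚ ℂ) → ℂ → ℂ, ∀ v s,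
      Y v s = Polynomial.eval₂ (algebraMap (algebraicClosure ℚ ℂ) ℂ) s (PowerSeries.trunc (Nv v) v) +
        s ^ Nv v * ρ v s := ⟨_, fun _ _ => rfl⟩
  obtain ⟨yt, hyt⟩ : ∃ yt : PowerSeries (algebraicClosure ℚ ℂ) → ℂ → ℂ, ∀ v u,
      yt v u = Y v (sf u) / sf u ^ N := ⟨_, fun _ _ => rfl⟩
  -- thresholds
  set R₁ : ℝ := max 1 ((2 / r) ^ n) with hR₁
  have hR₁1 : 1 ≤ R₁ := le_max_left _ _
  have hR₁0 : 0 ≤ R₁ := zero_le_one.trans hR₁1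
  have hsf_ball : ∀ u : ℂ, R₁ ≤ ‖u‖ → sf u ∈ ball (0 : ℂ) r ∧ sf u ≠ 0 := by
    intro u hu
    refine ⟨?_, by rw [hsf]; exact Complex.exp_ne_zero _⟩
    rw [mem_ball_zero_iff, hsf]
    exact (Literature.Analysis.Complex.BoundaryContour.norm_cexp_neg_logU_div_le hn hr
      (hR₁1.trans hu) ((le_max_right _ _).trans hu)).trans_lt (half_lt_self hr)
  have hsf_pow : ∀ u : ℂ, R₁ ≤ ‖u‖ → (sf u ^ n)⁻¹ = u := by
    intro u hu
    have hu0 : u ≠ 0 := norm_pos_iff.1 (by linarith)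
    rw [hsf, Literature.Analysis.Complex.BoundaryContour.cexp_neg_logU_div_pow hu0 hn.ne', inv_inv]
  -- the roots over `u`, `|u| ≥ R₁`, are the `ỹ_v(u)`
  have hroot_iff : ∀ u : ℂ, R₁ ≤ ‖u‖ → ∀ V : ℂ,
      (Q.map (eval₂RingHom (algebraMap ℚ ℂ) u)).eval V = 0 ↔ ∃ v ∈ S, V = yt v u := by
    intro u hu V
    obtain ⟨hb, h0⟩ := hsf_ball u hu
    have h := hroots (sf u) hb h0 V
    rw [hsf_pow u hu] at h
    simp only [hyt, hY]
    exact h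
  have hyt_inj : ∀ u : ℂ, R₁ ≤ ‖u‖ → ∀ v ∈ S, ∀ v' ∈ S, yt v u = yt v' u → v = v' := by
    intro u hu v hv v' hv' h
    by_contra hne
    obtain ⟨hb, h0⟩ := hsf_ball u hu
    refine hdist (sf u) hb h0 v hv v' hv' hne ?_
    rw [hyt, hyt, hY, hY] at h
    exact (div_left_inj' (pow_ne_zero N h0)).1 h
  have hroots_eq : ∀ u : ℂ, R₁ ≤ ‖u‖ →
      (Q.map (eval₂RingHom (algebraMap ℚ ℂ) u)).roots = (Finset.univ : Finset S).val.map fun v : S => yt v u := by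
    intro u hu
    have hinj : Function.Injective fun v : S => yt v u := fun v v' h =>
      Subtype.ext (hyt_inj u hu v v.2 v' v'.2 h)
    have hz : ∀ v : S, (Q.map (eval₂RingHom (algebraMap ℚ ℂ) u)).eval (yt v u) = 0 := fun v =>
      (hroot_iff u hu _).2 ⟨v, v.2, rfl⟩
    have h := (Literature.Analysis.Complex.FormalRoot.roots_eq_and_derivative_eval_ne_zero
      (hmonic.map _).ne_zero hinj (by rw [hmonic.natDegree_map, Fintype.card_coe, hcard]) hz).1
    rw [h, Finset.map_val]
    rfl
  -- continuity of the branches on the upper half-plane beyond `R₁`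
  have hsf_cont : ∀ u : ℂ, 0 < u.im → ContinuousAt sf u := by
    intro u hu
    have : sf = fun u => exp (-(log (-I * u) + (π / 2 : ℝ) * I) / n) := funext fun u => hsf u
    rw [this]
    exact Literature.Analysis.Complex.BoundaryContour.continuousAt_cexp_neg_logU_div
      (Literature.Analysis.Complex.BoundaryContour.neg_I_mul_mem_slitPlane (Or.inl hu)) n
  have hY_cont : ∀ v ∈ S, ∀ s ∈ ball (0 : ℂ) r, ContinuousAt (Y v) s := by
    intro v hv s hs
    have : Y v = fun s => Polynomial.eval₂ (algebraMap (algebraicClosure ℚ ℂ) ℂ) s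
        (PowerSeries.trunc (Nv v) v) + s ^ Nv v * ρ v s := funext fun s => hY v s
    rw [this]
    refine ContinuousAt.add ?_ ((continuousAt_id.pow _).mul (hρ v hv s hs).continuousAt)
    exact (Polynomial.continuous_eval₂ _ _).continuousAt
  have hyt_cont : ∀ v ∈ S, ∀ u : ℂ, 0 < u.im → R₁ ≤ ‖u‖ → ContinuousAt (yt v) u := by
    intro v hv u hu hRu
    have : yt v = fun u => Y v (sf u) / sf u ^ N := funext fun u => hyt v u
    rw [this]
    obtain ⟨hb, h0⟩ := hsf_ball u hRu
    exact (ContinuousAt.comp (g := Y v) (hY_cont v hv _ hb) (hsf_cont u hu)).div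
      ((hsf_cont u hu).pow N) (pow_ne_zero N h0)
  -- the signs are constant on the three pieces beyond `R₁`
  set W : Set ℂ := ({u : ℂ | R₁ < u.re} ∩ {u : ℂ | 0 < u.im}) ∪ {u : ℂ | R₁ < u.im} ∪
    ({u : ℂ | u.re < -R₁} ∩ {u : ℂ | 0 < u.im}) with hW
  set u₁ : ℂ := ((R₁ + 1 : ℝ) : ℂ) * I with hu₁
  have hu₁W : u₁ ∈ W := by
    refine Or.inl (Or.inr ?_)
    show R₁ < (((R₁ + 1 : ℝ) : ℂ) * I).im
    simp
  set η : PowerSeries (algebraicClosure ℚ ℂ) → ℝ := fun v =>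
    if (![u₁ + (c : ℂ) * (yt v u₁), (yt v u₁)] : Fin 2 → ℂ) ∈ H then 1 else -1 with hη
  have hηC : ∀ v, ((η v : ℝ) : ℂ) = (if (![u₁ + (c : ℂ) * (yt v u₁), (yt v u₁)] : Fin 2 → ℂ) ∈ H then (1 : ℂ) else -1) := by
    intro v
    simp only [hη]
    split_ifs <;> simp
  have hsignW : ∀ v ∈ S, ∀ u ∈ W, (if (![u + (c : ℂ) * (yt v u), (yt v u)] : Fin 2 → ℂ) ∈ H then (1 : ℂ) else -1) = ((η v : ℝ) : ℂ) := by
    intro v hv u hu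
    rw [hηC]
    refine sign_sheet_eq hH hN hdisj hQp (isPreconnected_threePieces R₁)
      (fun z hz => (lt_norm_of_mem_threePieces hR₁0 hz).2) (fun z hz => ?_) (fun z hz => ?_) hu₁W hu
    · obtain ⟨hz1, hz2⟩ := lt_norm_of_mem_threePieces hR₁0 hz
      exact (hyt_cont v hv z hz2 hz1.le).continuousWithinAt
    · exact (hroot_iff z (lt_norm_of_mem_threePieces hR₁0 hz).1.le _).2 ⟨v, hv, rfl⟩
  refine ⟨n, hn, N, S, Nv, ρ, r, η, 2 * R₁, hr, hcard, hNv, hρ, fun v _ => ?_, fun u hu hRu => ?_⟩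
  · simp only [hη]
    split_ifs
    · exact Or.inl rfl
    · exact Or.inr rfl
  · have hR₁u : R₁ ≤ ‖u‖ := by linarith
    have huW : u ∈ W := mem_threePieces hR₁0 hu hRu
    rw [fibreSum_eq_sum_sheets hF (hroots_eq u hR₁u), ← Finset.sum_coe_sort S]
    refine Finset.sum_congr rfl fun v _ => ?_
    rw [hsignW v v.2 u huW]
    congr 1
    rw [hyt, hY, Literature.FieldTheory.AlgClosed.PuiseuxInfinityAlgebraic.eval₂_trunc_eq_sum, hsf]

end Sheets

end Literature.AlgebraicGeometry.RealAlgebraic
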